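import Literature.AnabelianGeometry.EtaleTheta.Discharge.Sec2AutKHolds
import Literature.AnabelianGeometry.EtaleTheta.Discharge.Sec2Prop24Reduction

/-!
# [EtTh] Remark 2.6.1 (dotted curves) and Corollary 2.9 (all six members) DISCHARGED modulo
# Prop. 2.6, temp-slimness and the printed definition of `Δ̄_Θ` (proof-only companion)

Mochizuki, *The Étale Theta Function …* [EtTh], Publ. RIMS 45 (2009), §2, Remark 2.6.1 and
Corollary 2.9, PRIMS text pp.40, 43 (printed pp.266, 269; locators = PDF pages; bib key
`MochizukiEtTh2009`). Remark 2.6.1, last clause: "the 'Aut_K(−)'s' of the various 'once-dotted versions'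
of these orbicurves [cf. Definition 2.5, (ii)] are given by taking the direct product of the 'Aut_K(−)'s'
listed above with `Gal(Ċ^log/C^log) ≅ {±1}`" — computed, as printed, "by applying the Propositions 2.4,
2.6 to 'isomorphisms of fundamental groups arising from isomorphisms of the orbicurves in question'"
[cite: MochizukiEtTh2009, Rmk 2.6.1 p.40]; Corollary 2.9: for each of `Ẋ̲̲, Ċ̲, Ċ̲̲, X̲̲, C̲, C̲̲` the labels
`∈ (ℤ/lℤ)^±` are in bijection with the `Aut_K(−)`-orbits of cusps [cite: MochizukiEtTh2009, Cor 2.9 p.43].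

Cell abc-iut, layer L2, discharge seat abc-iut-L2-d3 (nodes EtTh:Rmk2.6.1, EtTh:Cor2.9), companion of
seat abc-iut-L2-t2's `ThetaCoversTempered.lean` (named facts `TemperedCoverData.Rmk261_dotted`,
`TemperedCoverData.Cor29_card`; `Aut_K(Z) = autK (Π^tp_Z) = N_{Π^tp_C}(Π^tp_Z)/Π^tp_Z`). PURE GROUP THEORY
over the interface; the inputs are taken BY NAME:

* `T.Prop26` — [EtTh] Prop. 2.6 (the typed named fact, existence of the extension of automorphisms of
  `Π^tp_Ż`, `Ż ∈ {Ẋ̲̲, Ẋ̲, Ċ̲̲, Ċ̲}`, to `Π^tp_C` stabilising `Π^tp_Z` and `Π^tp_Ċ`) — exactly the input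
  print names;
* `IsSlimGroup T.Gtp` — temp-slimness of `Π^tp_C` ([SemiAnbd] Prop. 3.6 (iv) / Ex. 3.10; the tree's
  `TemperedPiSlim`, proved over the L3 charts; not a field of `TemperedCoverData`, cf.
  `Sec2Prop24Reduction.lean`), which makes the extension of Prop. 2.6 UNIQUE, hence equal to the inner
  automorphism it came from;
* for the final group structures, the hypotheses of the undotted discharge (`Sec2AutKHolds.lean`):
  `hΘ : [Δ_X, Δ_X]·Ker = Δ̄_Θ`-preimage (printed definition "`Δ_Θ := Im(∧² Δ^ab_X)`", p.35), `HasMuL`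
  (`μ_l ⊆ K`, as printed), and for Cor. 2.9 the cusp hypotheses `hC1`, `hC2` of `Sec2CuspOrbits.lean`.

RESULTS, for `T : TemperedCoverData l` and `Z ∈ {Π^tp_{X̲̲}, Π^tp_{X̲}, Π^tp_{C̲̲}, Π^tp_{C̲}}`, `Ż := Z ∩ Π^tp_Ċ`:

* `index_PiXu`, `index_PiXuu`, `index_PiCu`, `index_PiCuu` — `[Π_C : Π_{X̲}] = 2l`, `[Π_C : Π_{X̲̲}] = 2l²`,
  `[Π_C : Π_{C̲}] = l`, `[Π_C : Π_{C̲̲}] = l²` (Rmk. 2.3.1 bookkeeping), whence `not_le_PiCdot_of_mem_four`: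
  **`Π^tp_Z ⊄ Π^tp_Ċ`** (`l` odd: `Ż → Z` is a genuine double covering);
* `normalizer_inf_PiCdot_eq` — **`N_{Π^tp_C}(Π^tp_Ż) = N_{Π^tp_C}(Π^tp_Z)`** from Prop. 2.6 + temp-slimness
  (the "computation" of Remark 2.6.1 for the dotted curves);
* `nonempty_quotient_inf_mulEquiv_prod` — the group theory of "direct product with `Gal(Ċ/C) ≅ {±1}`":
  `N/(Z ∩ D) ≅ N/Z × ℤ/2` for `D` of index `2`, `Z ⊴ N`, `Z ⊄ D`;
* `nonempty_autK_inf_PiCdot_mulEquiv` — **`Aut_K(Ż) ≅ Aut_K(Z) × ℤ/2ℤ`**;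
* `rmk261_dotted_of` — **`T.Rmk261_dotted`** (all four dotted clauses) from Prop. 2.6, slimness and `hΘ`;
* `natCard_cuspOrbits_inf_PiCdot`, `cor29_card_of` — **`T.Cor29_card` for ALL SIX members** from Prop. 2.6,
  slimness, `hΘ` and the cusp hypotheses `hC1`, `hC2` (the orbit spaces of `Ż` and `Z` coincide).

No new definition, no new named fact; nothing here asserts that a `TemperedCoverData` exists or that
`Prop26` holds; typed ≠ proved for the inputs taken by name; no side is taken on any disputed claim.
-/

namespace Literature.AnabelianGeometry.EtaleTheta

open Literature.AlgebraicGeometry.Frobenioids (IsSlimGroup)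

namespace ThetaCovers

universe u

/-! ### Group theory: "direct product with `Gal(Ċ/C) ≅ {±1}`" -/

section GroupTheory

variable {G : Type*} [Group G]

/-- A quotient by a (normal) subgroup of index `2` is `ℤ/2ℤ` (`Gal(Ċ^log/C^log) ≅ {±1}`, Rmk 2.6.1).
[cite: MochizukiEtTh2009, Rmk 2.6.1 p.40] -/
theorem nonempty_quotient_mulEquiv_zmod_two (D : Subgroup G) [D.Normal] (hD : D.index = 2) :
    Nonempty (G ⧸ D ≃* Multiplicative (ZMod 2)) := by
  have h1 : Nat.card (G ⧸ D) = 2 := by rw [← Subgroup.index_eq_card]; exact hD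
  have h2 : Nat.card (Multiplicative (ZMod 2)) = 2 := by simp
  exact ⟨mulEquivOfPrimeCardEq h1 h2⟩

/-- In `ℤ/2ℤ`: if `a ≠ e` and `b ≠ 1` then `a·b = e` (the group has two elements).
[cite: MochizukiEtTh2009, Rmk 2.6.1 p.40] -/
theorem zmod_two_mul_eq_of_ne {a b e : Multiplicative (ZMod 2)} (ha : a ≠ e) (hb : b ≠ 1) :
    a * b = e := by
  revert a b e
  decide

/-- **The group theory of "taking the direct product with `Gal(Ċ/C) ≅ {±1}`"** (Remark 2.6.1, dotted
clause): for `D ⊴ G` of index `2`, `Z ⊴ N ≤ G` with `Z ⊄ D` (so that `Z·(N ∩ D) = N`), the quotient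
`N/(Z ∩ D)` is `N/Z × G/D ≅ N/Z × ℤ/2ℤ` (the map `n ↦ (n mod Z, n mod D)` is onto with kernel `Z ∩ D`).
[cite: MochizukiEtTh2009, Rmk 2.6.1 p.40] -/
theorem nonempty_quotient_inf_mulEquiv_prod {N Z D : Subgroup G} [D.Normal] (hD : D.index = 2)
    (hZN : Z ≤ N) [hZ : (Z.subgroupOf N).Normal] [hZD' : ((Z ⊓ D).subgroupOf N).Normal]
    (hZD : ¬ Z ≤ D) :
    Nonempty (↥N ⧸ (Z ⊓ D).subgroupOf N ≃* (↥N ⧸ Z.subgroupOf N) × Multiplicative (ZMod 2)) := by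
  classical
  obtain ⟨e⟩ := nonempty_quotient_mulEquiv_zmod_two D hD
  -- the sign character `χ : G → G/D ≅ ℤ/2` with kernel `D`
  let χ : G →* Multiplicative (ZMod 2) := e.toMonoidHom.comp (QuotientGroup.mk' D)
  have hχ : ∀ g : G, χ g = 1 ↔ g ∈ D := fun g => by
    change e (QuotientGroup.mk g) = 1 ↔ g ∈ D
    rw [e.map_eq_one_iff, QuotientGroup.eq_one_iff]
  let f : ↥N →* (↥N ⧸ Z.subgroupOf N) × Multiplicative (ZMod 2) :=
    (QuotientGroup.mk' (Z.subgroupOf N)).prod (χ.comp N.subtype)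
  have hf : ∀ n : ↥N, f n = (QuotientGroup.mk n, χ n) := fun n => rfl
  -- kernel `= Z ∩ D`
  have hker : f.ker = (Z ⊓ D).subgroupOf N := by
    ext n
    rw [MonoidHom.mem_ker, hf, Prod.mk_eq_one, QuotientGroup.eq_one_iff, Subgroup.mem_subgroupOf,
      Subgroup.mem_subgroupOf, Subgroup.mem_inf, hχ]
  -- surjective: adjust the sign by an element of `Z ∖ D`
  obtain ⟨z₀, hz₀Z, hz₀D⟩ : ∃ z ∈ Z, z ∉ D := SetLike.not_le_iff_exists.mp hZD
  have hχz₀ : χ z₀ ≠ 1 := fun h => hz₀D ((hχ z₀).mp h)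
  let z₁ : ↥N := ⟨z₀, hZN hz₀Z⟩
  have hz₁ : (QuotientGroup.mk z₁ : ↥N ⧸ Z.subgroupOf N) = 1 := by
    rw [QuotientGroup.eq_one_iff, Subgroup.mem_subgroupOf]
    exact hz₀Z
  have hsurj : Function.Surjective f := by
    rintro ⟨q, ε⟩
    induction q using QuotientGroup.induction_on with
    | H n =>
      by_cases hε : χ n = ε
      · exact ⟨n, by rw [hf, hε]⟩
      · refine ⟨n * z₁, ?_⟩
        rw [hf, QuotientGroup.mk_mul, hz₁, mul_one, Subgroup.coe_mul, map_mul]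
        exact Prod.ext rfl (zmod_two_mul_eq_of_ne hε hχz₀)
  exact ⟨(QuotientGroup.quotientMulEquivOfEq hker.symm).trans
    (QuotientGroup.quotientKerEquivOfSurjective f hsurj)⟩

/-- If a subgroup `Z` of index not divisible by `4` lies in an index-`2` subgroup `M`, it lies in no
OTHER index-`2` subgroup `D` (`M ∩ D` would have index `4`). [cite: MochizukiEtTh2009, Rmk 2.6.1 p.40] -/
theorem not_le_of_index_two_of_ne {Z M D : Subgroup G} (hM : M.index = 2) (hD : D.index = 2)
    (hZM : Z ≤ M) (h4 : ¬ 4 ∣ Z.index) (hne : D ≠ M) : ¬ Z ≤ D := fun hZD =>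
  hne (Subgroup.eq_of_index_two_of_le hD hM hZD hZM h4)

end GroupTheory

/-! ### Slim groups: the extension of an inner automorphism of an open subgroup is inner -/

section Slim

variable {G : Type*} [Group G] [TopologicalSpace G] [IsTopologicalGroup G]

/-- In a slim topological group, an automorphism `Γ` that restricts on an OPEN subgroup `H` to the
conjugation by `n ∈ N(H)` IS the conjugation by `n` (uniqueness of the extension, [EtTh] Prop. 2.4/2.6
"induces"; `IsSlimGroup.apply_eq_self_of_eqOn` applied to `conj(n)⁻¹ ∘ Γ`).
[cite: MochizukiEtTh2009, Prop 2.6 p.40] -/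
theorem _root_.Literature.AlgebraicGeometry.Frobenioids.IsSlimGroup.eq_conj_of_eqOn
    (hG : IsSlimGroup G) {H : Subgroup G} (hH : IsOpen (H : Set G)) (Γ : G ≃* G) (n : G)
    (h : ∀ x ∈ H, Γ x = n * x * n⁻¹) (g : G) : Γ g = n * g * n⁻¹ := by
  let ψ : G →* G := ((MulAut.conj n)⁻¹).toMonoidHom.comp Γ.toMonoidHom
  have hψ : ∀ x, ψ x = n⁻¹ * Γ x * n := fun x => by
    change (MulAut.conj n)⁻¹ (Γ x) = _
    rw [MulAut.conj_inv_apply]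
  have key : ψ g = g := by
    refine hG.apply_eq_self_of_eqOn hH ψ (fun x hx => ?_) g
    rw [hψ, h x hx]; group
  rw [hψ] at key
  calc Γ g = n * (n⁻¹ * Γ g * n) * n⁻¹ := by group
    _ = n * g * n⁻¹ := by rw [key]

end Slim

namespace TemperedCoverData

variable {l : ℕ} (T : TemperedCoverData.{u} l)

/-! ### Index bookkeeping (Remark 2.3.1): `[Π_C : Π_{X̲}] = 2l`, `[Π_C : Π_{X̲̲}] = 2l²`,
`[Π_C : Π_{C̲}] = l`, `[Π_C : Π_{C̲̲}] = l²` -/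

/-- `[Π_C : Π_{X̲}] = 2l` (`[Π_X : Π_{X̲}] = l`, `[Π_C : Π_X] = 2`). [cite: MochizukiEtTh2009, Rmk 2.3.1 p.38] -/
theorem index_PiXu : T.PiXu.index = l * 2 := by
  obtain ⟨H', E, S, ι, hH', hι, -, hE, hS, hdef⟩ := T.isTypeLTorsThetaPm.out
  rw [T.PiXu_eq_inf hH' hι hE hS hdef]
  exact T.toCoverDataAx.index_inf_PiX hH'

/-- `[Π_C : Π_{X̲̲}] = 2l²` (`[Π_{X̲} : Π_{X̲̲}] = l`). [cite: MochizukiEtTh2009, Rmk 2.3.1 p.38] -/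
theorem index_PiXuu : T.PiXuu.index = l * (l * 2) := by
  obtain ⟨H', E, S, ι, hH', hι, h2, hE, hS, hdef⟩ := T.isTypeLTorsThetaPm.out
  rw [T.PiXuu_eq_sup hH' hι h2 hE hS hdef]
  have hT := hH'.inf_isTypeLTors
  have hle : S ⊔ E ≤ H' ⊓ T.PiX :=
    sup_le (hS.le.trans (sup_le hT.Dx_le (T.barKer_le_barTheta.trans hT.barTheta_le)))
      (hE.le.trans inf_le_left)
  rw [← Subgroup.relIndex_mul_index hle, T.index_typeLTorsTheta H' E S ι hH' hE hS,
    T.toCoverDataAx.index_inf_PiX hH']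

/-- `[Π_C : Π_{C̲}] = l` (`[Π_{C̲} : Π_{X̲}] = 2`). [cite: MochizukiEtTh2009, Rmk 2.3.1 p.38] -/
theorem index_PiCu : T.PiCu.index = l := by
  obtain ⟨H', E, S, ι, hH', hι, -, hE, hS, hdef⟩ := T.isTypeLTorsThetaPm.out
  rw [T.PiCu_eq hH' hι hE hS hdef]
  have h := Subgroup.relIndex_mul_index (inf_le_left : H' ⊓ T.PiX ≤ H')
  rw [hH'.relIndex_two, T.toCoverDataAx.index_inf_PiX hH'] at h
  omega

/-- `[Π_C : Π_{C̲̲}] = l²` (`[Π_{C̲̲} : Π_{X̲̲}] = 2`). [cite: MochizukiEtTh2009, Rmk 2.3.1 p.38] -/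
theorem index_PiCuu : T.PiCuu.index = l * l := by
  obtain ⟨H', E, S, ι, hH', hι, h2, hE, hS, hdef⟩ := T.isTypeLTorsThetaPm.out
  have hXuu := T.index_PiXuu
  rw [T.PiXuu_eq_sup hH' hι h2 hE hS hdef] at hXuu
  have h := Subgroup.relIndex_mul_index (le_sup_left : S ⊔ E ≤ (S ⊔ E) ⊔ Subgroup.zpowers ι)
  rw [T.toCoverDataAx.relIndex_sup_zpowers hH' rfl hι hE hS h2, hXuu] at h
  rw [hdef]
  have : 2 * ((S ⊔ E) ⊔ Subgroup.zpowers ι).index = 2 * (l * l) := by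
    rw [h]; ring
  omega

/-- `[Π^tp_C : Π^tp_X ∩ Π^tp_Ċ] = 4`: `Π^tp_X ≠ Π^tp_Ċ` are two index-`2` subgroups (`Gal(Ẍ/C) ≅ (ℤ/2ℤ)³`
has the quotient `Gal(Ẋ/C) ≅ (ℤ/2ℤ)²`, Def 1.7). [cite: MochizukiEtTh2009, Def 2.5 (ii) p.39] -/
theorem not_four_dvd_of_odd {n : ℕ} (hn : Odd n) (k : ℕ) (hk : k = 1 ∨ k = 2) : ¬ 4 ∣ n ^ k * 2 := by
  obtain ⟨m, rfl⟩ := hn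
  rcases hk with rfl | rfl
  · intro h
    rw [pow_one] at h
    omega
  · intro h
    have : (2 * m + 1) ^ 2 * 2 = 4 * (2 * m * m + 2 * m) + 2 := by ring
    omega

/-- **`Π^tp_Z ⊄ Π^tp_Ċ`** for `Z ∈ {X̲̲, X̲, C̲̲, C̲}` (`l` odd): `[Π_C : Π_{C̲}] = l` and `[Π_C : Π_{C̲̲}] = l²` are
odd while `[Π^tp_C : Π^tp_Ċ] = 2`; `[Π_C : Π_{X̲}] = 2l`, `[Π_C : Π_{X̲̲}] = 2l²` are not divisible by
`4 = [Π^tp_C : Π^tp_X ∩ Π^tp_Ċ]` (`Π^tp_Ċ ≠ Π^tp_X`). So `Ż → Z` is a genuine double covering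
(Def 2.5 (ii)). [cite: MochizukiEtTh2009, Def 2.5 (ii) p.39] -/
theorem not_le_PiCdot_of_mem_four {Z : Subgroup T.Gtp}
    (hZ : Z ∈ [T.tp T.PiXuu, T.tp T.PiXu, T.tp T.PiCuu, T.tp T.PiCu]) : ¬ Z ≤ T.PiCdot := by
  have hl : Odd l := T.l_odd
  have hXle : T.PiXu ≤ T.PiX :=
    sup_le (inf_le_right : T.PiXuu ≤ T.PiX) (T.barTheta_le.trans inf_le_left)
  simp only [List.mem_cons, List.mem_nil_iff, or_false] at hZ
  rcases hZ with rfl | rfl | rfl | rfl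
  · refine not_le_of_index_two_of_ne T.index_tp_PiX T.index_PiCdot
      (Subgroup.comap_mono (inf_le_right : T.PiXuu ≤ T.PiX)) ?_ T.PiCdot_ne
    rw [T.index_tp T.isOpen_PiXuu, T.index_PiXuu, ← mul_assoc, ← pow_two]
    exact not_four_dvd_of_odd hl 2 (Or.inr rfl)
  · refine not_le_of_index_two_of_ne T.index_tp_PiX T.index_PiCdot (Subgroup.comap_mono hXle) ?_
      T.PiCdot_ne
    rw [T.index_tp T.isOpen_PiXu, T.index_PiXu, ← pow_one l]
    exact not_four_dvd_of_odd hl 1 (Or.inl rfl)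
  · intro hle
    have h := Subgroup.index_dvd_of_le hle
    rw [T.index_PiCdot, T.index_tp T.isOpen_PiCuu, T.index_PiCuu] at h
    obtain ⟨m, rfl⟩ := hl
    have : (2 * m + 1) * (2 * m + 1) = 2 * (2 * m * m + 2 * m) + 1 := by ring
    omega
  · intro hle
    have h := Subgroup.index_dvd_of_le hle
    rw [T.index_PiCdot, T.index_tp T.isOpen_PiCu, T.index_PiCu] at h
    obtain ⟨m, rfl⟩ := hl
    omega

/-! ### Remark 2.6.1, dotted curves: `N_{Π^tp_C}(Π^tp_Ż) = N_{Π^tp_C}(Π^tp_Z)` from Prop. 2.6 -/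

/-- **`N_{Π^tp_C}(Π^tp_Z ∩ Π^tp_Ċ) = N_{Π^tp_C}(Π^tp_Z)`** for `Z ∈ {X̲̲, X̲, C̲̲, C̲}` — "by applying the
Propositions 2.4, 2.6 to 'isomorphisms of fundamental groups arising from isomorphisms of the orbicurves in
question'" (Rmk 2.6.1): for `n` normalising `Π^tp_Ż`, Prop. 2.6 extends the inner automorphism `conj(n)|`
of `Π^tp_Ż` to an automorphism `Γ` of `Π^tp_C` stabilising `Π^tp_Z`; by temp-slimness `Γ = conj(n)`, so
`n` normalises `Π^tp_Z`. Conversely `Π^tp_Ċ ⊴ Π^tp_C` (index `2`). Inputs BY NAME: `T.Prop26` (Prop. 2.6,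
typed named fact) and `IsSlimGroup T.Gtp` ([SemiAnbd] Prop. 3.6 (iv): `Π^tp_C` is temp-slim).
[cite: MochizukiEtTh2009, Rmk 2.6.1 p.40] -/
theorem normalizer_inf_PiCdot_eq (hslim : IsSlimGroup T.Gtp) (h26 : T.Prop26) {Z : Subgroup T.Gtp}
    (hZ : Z ∈ [T.tp T.PiXuu, T.tp T.PiXu, T.tp T.PiCuu, T.tp T.PiCu]) :
    Subgroup.normalizer ((Z ⊓ T.PiCdot : Subgroup T.Gtp) : Set T.Gtp) =
      Subgroup.normalizer ((Z : Subgroup T.Gtp) : Set T.Gtp) := by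
  haveI hD : T.PiCdot.Normal := Subgroup.normal_of_index_eq_two T.index_PiCdot
  refine le_antisymm (fun n hn => ?_) (normalizer_le_normalizer_inf Z T.PiCdot)
  set H : Subgroup T.Gtp := Z ⊓ T.PiCdot with hHdef
  have hHopen : IsOpen (H : Set T.Gtp) := (T.isOpen_of_mem_four hZ).inter T.isOpen_PiCdot
  -- the inner automorphism `conj(n)|_H` as a continuous automorphism of `H = Π^tp_Ż`
  let γ₀ : ↥H ≃* ↥H := H.normalizerMonoidHom ⟨n, hn⟩
  have hγ₀ : ∀ h : ↥H, ((γ₀ h : ↥H) : T.Gtp) = n * h * n⁻¹ := fun h => rfl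
  let γ : ↥H ≃ₜ* ↥H :=
    { γ₀ with
      continuous_toFun := by
        apply Continuous.subtype_mk
        exact (continuous_const.mul continuous_subtype_val).mul continuous_const
      continuous_invFun := by
        apply Continuous.subtype_mk
        exact (continuous_const.mul continuous_subtype_val).mul continuous_const }
  have hγ : ∀ h : ↥H, ((γ h : ↥H) : T.Gtp) = n * h * n⁻¹ := fun h => rfl
  -- Prop. 2.6: the extension `Γ` stabilising `Π^tp_Z`
  obtain ⟨Γ, hΓ, hstab⟩ := h26 Z hZ γ
  have hΓZ : Z.map Γ.toMulEquiv.toMonoidHom = Z :=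
    hstab Z (List.mem_cons_of_mem _ (List.mem_cons_self))
  -- temp-slimness: `Γ = conj(n)`
  have hconj : ∀ g : T.Gtp, Γ.toMulEquiv g = n * g * n⁻¹ := by
    refine hslim.eq_conj_of_eqOn hHopen Γ.toMulEquiv n fun x hx => ?_
    have := hΓ ⟨x, hx⟩
    change Γ.toMulEquiv x = ((γ ⟨x, hx⟩ : ↥H) : T.Gtp) at this
    rw [this, hγ]
  -- hence `n` normalises `Π^tp_Z`
  rw [Subgroup.mem_normalizer_iff_map_conj_eq]
  conv_rhs => rw [← hΓZ]
  refine SetLike.ext fun x => ?_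
  simp only [Subgroup.mem_map]
  constructor
  · rintro ⟨z, hz, rfl⟩
    exact ⟨z, hz, by rw [MulEquiv.coe_toMonoidHom, hconj]; rfl⟩
  · rintro ⟨z, hz, rfl⟩
    exact ⟨z, hz, by rw [MulEquiv.coe_toMonoidHom, hconj]; rfl⟩

/-- **`Aut_K(Ż) ≅ Aut_K(Z) × Gal(Ċ/C)`** (Remark 2.6.1, dotted clause), i.e.
`N(Π^tp_Ż)/Π^tp_Ż ≅ N(Π^tp_Z)/Π^tp_Z × ℤ/2ℤ` for `Z ∈ {X̲̲, X̲, C̲̲, C̲}`, `Π^tp_Ż = Π^tp_Z ∩ Π^tp_Ċ` — from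
Prop. 2.6 and temp-slimness (`normalizer_inf_PiCdot_eq`) and `Π^tp_Z ⊄ Π^tp_Ċ` (`l` odd).
[cite: MochizukiEtTh2009, Rmk 2.6.1 p.40] -/
theorem nonempty_autK_inf_PiCdot_mulEquiv (hslim : IsSlimGroup T.Gtp) (h26 : T.Prop26)
    {Z : Subgroup T.Gtp} (hZ : Z ∈ [T.tp T.PiXuu, T.tp T.PiXu, T.tp T.PiCuu, T.tp T.PiCu]) :
    Nonempty (T.autK (Z ⊓ T.PiCdot) ≃* T.autK Z × Multiplicative (ZMod 2)) := by
  haveI hD : T.PiCdot.Normal := Subgroup.normal_of_index_eq_two T.index_PiCdot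
  have hN := T.normalizer_inf_PiCdot_eq hslim h26 hZ
  set N := Subgroup.normalizer ((Z : Subgroup T.Gtp) : Set T.Gtp) with hNdef
  have hZN : Z ≤ N := Subgroup.le_normalizer
  have hZDN : Z ⊓ T.PiCdot ≤ N := inf_le_left.trans hZN
  haveI : ((Z ⊓ T.PiCdot).subgroupOf N).Normal :=
    (Subgroup.normal_subgroupOf_iff_le_normalizer hZDN).mpr hN.ge
  obtain ⟨e1⟩ := nonempty_quotient_subgroupOf_congr (K := Z ⊓ T.PiCdot) hN
  obtain ⟨e2⟩ := nonempty_quotient_inf_mulEquiv_prod (N := N) T.index_PiCdot hZN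
    (T.not_le_PiCdot_of_mem_four hZ)
  exact ⟨e1.trans e2⟩

/-! ### Remark 2.6.1, dotted clauses -/

/-- **Remark 2.6.1 for the once-dotted curves DISCHARGED modulo Prop. 2.6, temp-slimness and the printed
definition of `Δ̄_Θ`**: the named fact `T.Rmk261_dotted` of `ThetaCoversTempered.lean` —
`Aut_K(Ẋ̲̲) ≅ (μ_l × {±1}) × {±1}`, `Aut_K(Ẋ̲) ≅ (ℤ/lℤ ⋊ {±1}) × {±1}`, `Aut_K(Ċ̲̲) ≅ μ_l × {±1}`, `Aut_K(Ċ̲) ≅ {±1}`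
under `μ_l ⊆ K` — from `T.Prop26` (Prop. 2.6, BY NAME), `IsSlimGroup T.Gtp` (temp-slimness of `Π^tp_C`) and
`hΘ : [Δ_X, Δ_X]·Ker = Δ̄_Θ`-preimage (used only through the undotted `rmk261_of`).
[cite: MochizukiEtTh2009, Rmk 2.6.1 p.40] -/
theorem rmk261_dotted_of [NeZero l] (hslim : IsSlimGroup T.Gtp) (h26 : T.Prop26)
    (hΘ : ⁅T.DeltaX, T.DeltaX⁆ ⊔ T.barKer = T.barTheta) : T.Rmk261_dotted := by
  intro hmu
  obtain ⟨hXuu, hXu, hCuu, hCu⟩ := T.rmk261_of hΘ hmu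
  have m1 : T.tp T.PiXuu ∈ [T.tp T.PiXuu, T.tp T.PiXu, T.tp T.PiCuu, T.tp T.PiCu] := by simp
  have m2 : T.tp T.PiXu ∈ [T.tp T.PiXuu, T.tp T.PiXu, T.tp T.PiCuu, T.tp T.PiCu] := by simp
  have m3 : T.tp T.PiCuu ∈ [T.tp T.PiXuu, T.tp T.PiXu, T.tp T.PiCuu, T.tp T.PiCu] := by simp
  have m4 : T.tp T.PiCu ∈ [T.tp T.PiXuu, T.tp T.PiXu, T.tp T.PiCuu, T.tp T.PiCu] := by simp
  obtain ⟨e1⟩ := T.nonempty_autK_inf_PiCdot_mulEquiv hslim h26 m1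
  obtain ⟨e2⟩ := T.nonempty_autK_inf_PiCdot_mulEquiv hslim h26 m2
  obtain ⟨e3⟩ := T.nonempty_autK_inf_PiCdot_mulEquiv hslim h26 m3
  obtain ⟨e4⟩ := T.nonempty_autK_inf_PiCdot_mulEquiv hslim h26 m4
  obtain ⟨f1⟩ := hXuu
  obtain ⟨f2⟩ := hXu
  obtain ⟨f3⟩ := hCuu
  haveI : Unique (T.autK (T.tp T.PiCu)) := @uniqueOfSubsingleton _ hCu 1
  exact ⟨⟨e1.trans (MulEquiv.prodCongr f1 (MulEquiv.refl _))⟩,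
    ⟨e2.trans (MulEquiv.prodCongr f2 (MulEquiv.refl _))⟩,
    ⟨e3.trans (MulEquiv.prodCongr f3 (MulEquiv.refl _))⟩,
    ⟨e4.trans MulEquiv.uniqueProd⟩⟩

/-! ### Corollary 2.9, all six members -/

/-- The `Aut_K`-orbit spaces of cusps of `Ż` and of `Z` COINCIDE (`Z ∈ {X̲̲, X̲, C̲̲, C̲}`): both are
`N(Π^tp_Z)\Π^tp_C/cuspStabC` since `N(Π^tp_Ż) = N(Π^tp_Z)` ("tracing through the definitions of the various
smooth log orbicurves [cf. Remark 2.6.1]", Cor 2.9). [cite: MochizukiEtTh2009, Cor 2.9 p.43] -/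
theorem natCard_cuspOrbits_inf_PiCdot (hslim : IsSlimGroup T.Gtp) (h26 : T.Prop26)
    {Z : Subgroup T.Gtp} (hZ : Z ∈ [T.tp T.PiXuu, T.tp T.PiXu, T.tp T.PiCuu, T.tp T.PiCu]) :
    Nat.card (T.cuspOrbits (Z ⊓ T.PiCdot)) = Nat.card (T.cuspOrbits Z) := by
  unfold cuspOrbits
  rw [T.normalizer_inf_PiCdot_eq hslim h26 hZ]

/-- **Corollary 2.9 DISCHARGED for all six members `Ẋ̲̲, Ċ̲, Ċ̲̲, X̲̲, C̲, C̲̲`** (the typed `T.Cor29_card`: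
`#(Aut_K(−)-orbits of cusps) = #(ℤ/lℤ)^± = (l+1)/2` under `μ_l ⊆ K`), modulo: `T.Prop26` (Prop. 2.6, BY NAME)
and `IsSlimGroup T.Gtp` (temp-slimness) for the dotted members; the printed definition `hΘ` of `Δ̄_Θ` and the
cusp hypotheses `hC1`, `hC2` of `Sec2CuspOrbits.lean` for the undotted count (`cor29_card_undotted_of`).
[cite: MochizukiEtTh2009, Cor 2.9 p.43] -/
theorem cor29_card_of (hslim : IsSlimGroup T.Gtp) (h26 : T.Prop26)
    (hΘ : ⁅T.DeltaX, T.DeltaX⁆ ⊔ T.barKer = T.barTheta)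
    (hC1 : T.cuspStabC ⊓ T.tp T.PiX ≤ T.tp T.PiXu) (hC2 : ¬ T.cuspStabC ≤ T.tp T.PiX) :
    T.Cor29_card := by
  intro hmu S hS
  have hund := T.cor29_card_undotted_of hΘ hC1 hC2 hmu
  have m1 : T.tp T.PiXuu ∈ [T.tp T.PiXuu, T.tp T.PiXu, T.tp T.PiCuu, T.tp T.PiCu] := by simp
  have m3 : T.tp T.PiCuu ∈ [T.tp T.PiXuu, T.tp T.PiXu, T.tp T.PiCuu, T.tp T.PiCu] := by simp
  have m4 : T.tp T.PiCu ∈ [T.tp T.PiXuu, T.tp T.PiXu, T.tp T.PiCuu, T.tp T.PiCu] := by simp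
  simp only [List.mem_cons, List.not_mem_nil, or_false] at hS
  rcases hS with rfl | rfl | rfl | rfl | rfl | rfl
  · rw [T.natCard_cuspOrbits_inf_PiCdot hslim h26 m1]; exact hund _ (by simp)
  · rw [T.natCard_cuspOrbits_inf_PiCdot hslim h26 m4]; exact hund _ (by simp)
  · rw [T.natCard_cuspOrbits_inf_PiCdot hslim h26 m3]; exact hund _ (by simp)
  · exact hund _ (by simp)
  · exact hund _ (by simp)
  · exact hund _ (by simp)

end TemperedCoverData

end ThetaCovers

end Literature.AnabelianGeometry.EtaleTheta
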